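import Summits.MatrixMultiplication.OmegaCensus.GoldenProducts
import Summits.MatrixMultiplication.OmegaCensus.QuadPhaseBlocks
import Summits.MatrixMultiplication.OmegaCensus.EisClassCheck

/-!
# ω-census, family (b3): conjecture C9 — the golden groups `𝔽_p[ζ₅] ⋊ C₅`: lattice calculus, coefficient pairs and the decidable CLASS CHECK

HONEST FRAMING (pub-omega census; verbatim): lottery ticket; floor = certified bounds/negative ranges.
Census BOOKKEEPING (conjecture C9 of the cell; pub-omega stpp-1 gen 22).  Vocabulary for the uniform theorem on
`GoldCyc p τ = 𝔽_p[ζ] ⋊_ζ ℤ/5` (`GoldenCyclic.lean`; `τ² + τ = 1`, `ζ² = τζ − 1`; for `p ≡ 4 (mod 5)` the Schmidt atom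
`A(p,5) = 𝔽_{p²} ⋊ C₅`).  THUE LATTICE: a short vector `(x, y)`, `y ≡ τ x (mod p)`, gives `X = x/8`, `Y = y/8 ∈ 𝔽_p` with
`τX = Y`, `τY = X − Y`; the lattice `ℤX + ℤY` is `τ`-stable (`ltau`), so `ℤX + ℤY + (ℤX + ℤY)ζ ⊂ 𝔽_p[ζ]` is `ζ`-stable: a
LATTICE ELEMENT is a pair of coefficient pairs `V = ((a₀,a₁),(b₀,b₁)) ↦ (a₀X + a₁Y) + (b₀X + b₁Y)ζ` (`toGold`), and
`ζ · V = (−B, A + τ̂B)` (`lz`, `toGold_lz`), `ζ^k · V = lzpow k V` (`act_gz_toGold`).  BOX: `Y = {1, a^α, b}`,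
`W = {1, a^β, b^t}` with `α, β` lattice elements `A, B` (`gbox`).  Every coordinate of every product `ζ^s α`, `ζ^s β` is
`(c₀x + c₁y)/8` with an explicit coefficient pair (`gR/gI`), so its ERROR is `c₀x + c₁y = O(√p)` and its PHASE is
`≡ c₀γ₀ + c₁γ₁ (mod 8)`, `γ₀ = −p x`, `γ₁ = −p y (mod 8)` (`EisArcs.phase_residue`).  The phase shift / error of a column pair in
one coordinate is the four-term signed sum `lin` (here with levels in `ℤ/5`) of these, i.e. ONE coefficient pair
`coefR/coefI ∈ ℤ × ℤ` (`map_lin`): `E = C₀x + C₁y`, `|E| ≤ (|C₀| + |C₁|)·ε`, `Φ ≡ C₀γ₀ + C₁γ₁ (mod 8)`.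
CLASS = `(γ₀, γ₁) ∈ (ℤ/8)²` (primitive) and optionally the sign `σ` of `y` (`x > 0` always).  `ClassDataG` / `ClassOKG`
(decidable): box, 2-D phase pattern per column, trim COEFFICIENTS (trims `= coefficient · ε`), and for every pair of columns /
phases the sign-aware residue form of `PairOK` in the real OR the imaginary coordinate (`OKsf`, `PairBarG`).  Per-prime EXACT
certificates use `CertOK` (the same with the exact errors and integer trims).  Theorems: `GoldenUniform.lean`.
Seat numerics / exact Python model: HOME/pub-omega-stpp-1-g22/code/gold.py.  Nothing here is progress on `ω`.
-/

namespace Summit.MatrixMultiplication.OmegaCensus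

open Finset

namespace GoldArcs

/-! ### Levels in `ℤ/5`: `col`, `lin`, `map_lin` (the `q = 5` copy of `PhaseArcs.col/lin`) -/

/-- Data supported on the middle `Y`/`W`-element: `col a s i = a s` if `i = 1`, else `0`. [folklore] -/
def col {R : Type*} [Zero R] (a : ZMod 5 → R) : ZMod 5 → Fin 3 → R := fun s i => if i = 1 then a s else 0

/-- The common shape of the phase shift / error of a column pair for the box `Y = {1, a^α, b}`, `W = {1, a^β, b^t}`:
`a(s₁)·[i'=1] − b(s₁)·[j=1] + b(s₂)·[j'=1] − a(s₃)·[i=1]` with `Y`-levels `(0,0,1)` and `W`-levels `(0,0,t)`. [folklore] -/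
def lin {R : Type*} [AddCommGroup R] (t : ZMod 5) (a b : ZMod 5 → R) (c c' : Fin 3 × Fin 3) : R :=
  col a ((![0, 0, 1] : Fin 3 → ZMod 5) c.1 + (![0, 0, t] : Fin 3 → ZMod 5) c'.2) c'.1
    - col b ((![0, 0, 1] : Fin 3 → ZMod 5) c.1 + (![0, 0, t] : Fin 3 → ZMod 5) c'.2) c.2
    + col b ((![0, 0, 1] : Fin 3 → ZMod 5) c.1 + (![0, 0, t] : Fin 3 → ZMod 5) c.2) c'.2
    - col a ((![0, 0, 1] : Fin 3 → ZMod 5) c'.1 + (![0, 0, t] : Fin 3 → ZMod 5) c'.2) c.1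

/-- `lin` commutes with additive maps. [folklore] -/
theorem map_lin {R S : Type*} [AddCommGroup R] [AddCommGroup S] (g : R →+ S) (t : ZMod 5) (a b : ZMod 5 → R)
    (c c' : Fin 3 × Fin 3) : g (lin t a b c c') = lin t (g ∘ a) (g ∘ b) c c' := by
  simp only [lin, col, map_sub, map_add, Function.comp_apply]
  split_ifs <;> simp only [map_zero]

/-! ### Lattice calculus -/

/-- `τ̂ (c₀, c₁) = (c₁, c₀ − c₁)`: the action of `τ` on `ℤX + ℤY` (`τX = Y`, `τY = X − Y`). [folklore] -/
def ltau (v : ℤ × ℤ) : ℤ × ℤ := (v.2, v.1 - v.2)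

/-- `ζ · (A + Bζ) = −B + (A + τB)ζ` on lattice elements. [folklore] -/
def lz (V : (ℤ × ℤ) × (ℤ × ℤ)) : (ℤ × ℤ) × (ℤ × ℤ) := (-V.2, V.1 + ltau V.2)

/-- `ζ^k · V` on lattice elements. [folklore] -/
def lzpow : ℕ → (ℤ × ℤ) × (ℤ × ℤ) → (ℤ × ℤ) × (ℤ × ℤ)
  | 0, V => V
  | k + 1, V => lz (lzpow k V)

variable {p : ℕ} {τ : ZMod p}

/-- Evaluation of a coefficient pair at `(X, Y)`: `c₀X + c₁Y`. [folklore] -/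
def ev (X Y : ZMod p) : ℤ × ℤ →+ ZMod p where
  toFun v := (v.1 : ZMod p) * X + (v.2 : ZMod p) * Y
  map_zero' := by simp
  map_add' v w := by simp only [Prod.fst_add, Prod.snd_add, Int.cast_add]; ring

/-- Evaluation of a coefficient pair at integers `(x, y)`: `c₀x + c₁y` (the error). [folklore] -/
def evZ (x y : ℤ) : ℤ × ℤ →+ ℤ where
  toFun v := v.1 * x + v.2 * y
  map_zero' := by simp
  map_add' v w := by simp only [Prod.fst_add, Prod.snd_add]; ring

/-- Evaluation of a coefficient pair at residues `(γ₀, γ₁) ∈ (ℤ/8)²`: `c₀γ₀ + c₁γ₁` (the phase residue). [folklore] -/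
def ev8 (γ₀ γ₁ : ZMod 8) : ℤ × ℤ →+ ZMod 8 where
  toFun v := (v.1 : ZMod 8) * γ₀ + (v.2 : ZMod 8) * γ₁
  map_zero' := by simp
  map_add' v w := by simp only [Prod.fst_add, Prod.snd_add, Int.cast_add]; ring

/-- The element of `𝔽_p[ζ]` with lattice coordinates `V`. [folklore] -/
def toGold (X Y : ZMod p) (V : (ℤ × ℤ) × (ℤ × ℤ)) : Gold p τ := ⟨ev X Y V.1, ev X Y V.2⟩

/-- `τ · ev v = ev (τ̂ v)` when `τX = Y`, `τ² + τ = 1`. [folklore] -/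
theorem tau_mul_ev (hτ : τ ^ 2 + τ = 1) {X Y : ZMod p} (h : τ * X = Y) (v : ℤ × ℤ) :
    τ * ev X Y v = ev X Y (ltau v) := by
  have h2 : τ * Y = X - Y := Gold.tau_mul_thue hτ h
  simp only [ev, ltau, AddMonoidHom.coe_mk, ZeroHom.coe_mk, Int.cast_sub]
  linear_combination (v.1 : ZMod p) * h + (v.2 : ZMod p) * h2

/-- **`ζ · toGold V = toGold (lz V)`.** [folklore] -/
theorem gz_mul_toGold (hτ : τ ^ 2 + τ = 1) {X Y : ZMod p} (h : τ * X = Y) (V : (ℤ × ℤ) × (ℤ × ℤ)) :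
    Gold.gz * toGold X Y V = (toGold X Y (lz V) : Gold p τ) := by
  rw [toGold, Gold.gz_mul, toGold]
  ext
  · simp [lz]
  · simp only [lz, map_add, tau_mul_ev hτ h]

/-- **`ζ^s · toGold V = toGold (lzpow s V)`** (the `RCyc` action). [folklore] -/
theorem act_gz_toGold (hτ : τ ^ 2 + τ = 1) {X Y : ZMod p} (h : τ * X = Y) (s : ZMod 5) (V : (ℤ × ℤ) × (ℤ × ℤ)) :
    RCyc.act Gold.gz s * toGold X Y V = (toGold X Y (lzpow s.val V) : Gold p τ) := by
  unfold RCyc.act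
  induction s.val with
  | zero => rw [pow_zero, one_mul]; rfl
  | succ k ih => rw [pow_succ', mul_assoc, ih, gz_mul_toGold hτ h]; rfl

/-! ### The box and its coefficient pairs -/

/-- The box `Y = {1, a^α, b}`, `W = {1, a^β, b^t}` of `𝔽_p[ζ] ⋊ ℤ/5` with `α, β` the lattice elements `A, B`. [folklore] -/
def gbox (X Y : ZMod p) (A B : (ℤ × ℤ) × (ℤ × ℤ)) (t : ZMod 5) : RCyc.RBox (Gold p τ) 5 :=
  ⟨![0, toGold X Y A, 0], ![0, 0, 1], ![0, toGold X Y B, 0], ![0, 0, t]⟩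

/-- Coefficient pair of the real part of `ζ^s · V`. [folklore] -/
def gR (V : (ℤ × ℤ) × (ℤ × ℤ)) : ZMod 5 → ℤ × ℤ := fun s => (lzpow s.val V).1
/-- Coefficient pair of the imaginary part of `ζ^s · V`. [folklore] -/
def gI (V : (ℤ × ℤ) × (ℤ × ℤ)) : ZMod 5 → ℤ × ℤ := fun s => (lzpow s.val V).2

/-- Coefficient pair `(C₀, C₁)` of the column pair `(c, c')`, real coordinate: error `C₀x + C₁y`, phase `≡ C₀γ₀ + C₁γ₁`. [folklore] -/
def coefR (A B : (ℤ × ℤ) × (ℤ × ℤ)) (t : ZMod 5) (c c' : Fin 3 × Fin 3) : ℤ × ℤ := lin t (gR A) (gR B) c c'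
/-- Coefficient pair of the column pair `(c, c')`, imaginary coordinate. [folklore] -/
def coefI (A B : (ℤ × ℤ) × (ℤ × ℤ)) (t : ZMod 5) (c c' : Fin 3 × Fin 3) : ℤ × ℤ := lin t (gI A) (gI B) c c'

/-- `S = |C₀| + |C₁|` (`|E| ≤ S·ε` when `|x|, |y| ≤ ε`). [folklore] -/
def Sab (C : ℤ × ℤ) : ℤ := |C.1| + |C.2|

/-- `|C₀x + C₁y| ≤ (|C₀| + |C₁|)·ε`. [folklore] -/
theorem abs_evZ_le {x y ε : ℤ} (hx : |x| ≤ ε) (hy : |y| ≤ ε) (C : ℤ × ℤ) : |evZ x y C| ≤ Sab C * ε := by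
  simp only [evZ, AddMonoidHom.coe_mk, ZeroHom.coe_mk, Sab]
  calc |C.1 * x + C.2 * y| ≤ |C.1 * x| + |C.2 * y| := abs_add_le _ _
    _ = |C.1| * |x| + |C.2| * |y| := by rw [abs_mul, abs_mul]
    _ ≤ |C.1| * ε + |C.2| * ε := add_le_add (mul_le_mul_of_nonneg_left hx (abs_nonneg _))
        (mul_le_mul_of_nonneg_left hy (abs_nonneg _))
    _ = (|C.1| + |C.2|) * ε := by ring

/-! ### Known signs: `x > 0` always; `σ ∈ {1, −1, 0}` the sign of `y` when known -/

/-- `C₀x + C₁y ≤ 0` is forced: `C₀ ≤ 0` and (`C₁ = 0`, or the sign of `y` is known and `C₁y ≤ 0`). [folklore] -/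
def Nonpos (σ : ℤ) (C : ℤ × ℤ) : Prop := C.1 ≤ 0 ∧ (C.2 = 0 ∨ (σ = 1 ∧ C.2 ≤ 0) ∨ (σ = -1 ∧ 0 ≤ C.2))
/-- `0 ≤ C₀x + C₁y` is forced. [folklore] -/
def Nonneg (σ : ℤ) (C : ℤ × ℤ) : Prop := 0 ≤ C.1 ∧ (C.2 = 0 ∨ (σ = 1 ∧ 0 ≤ C.2) ∨ (σ = -1 ∧ C.2 ≤ 0))

/-- `Nonpos` is decidable. [folklore] -/
instance (σ : ℤ) (C : ℤ × ℤ) : Decidable (Nonpos σ C) := by unfold Nonpos; infer_instance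
/-- `Nonneg` is decidable. [folklore] -/
instance (σ : ℤ) (C : ℤ × ℤ) : Decidable (Nonneg σ C) := by unfold Nonneg; infer_instance

/-- `Nonpos` forces `C₀x + C₁y ≤ 0` (`x > 0`, `σ = 1 ⇒ y ≥ 0`, `σ = −1 ⇒ y ≤ 0`). [folklore] -/
theorem evZ_nonpos {σ x y : ℤ} (hx : 0 < x) (hy₁ : σ = 1 → 0 ≤ y) (hy₂ : σ = -1 → y ≤ 0) {C : ℤ × ℤ}
    (h : Nonpos σ C) : evZ x y C ≤ 0 := by
  simp only [evZ, AddMonoidHom.coe_mk, ZeroHom.coe_mk]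
  obtain ⟨h1, h2⟩ := h
  have t1 : C.1 * x ≤ 0 := mul_nonpos_iff.2 (Or.inr ⟨h1, hx.le⟩)
  have t2 : C.2 * y ≤ 0 := by
    rcases h2 with h | ⟨hs, h⟩ | ⟨hs, h⟩
    · rw [h, zero_mul]
    · exact mul_nonpos_iff.2 (Or.inr ⟨h, hy₁ hs⟩)
    · exact mul_nonpos_iff.2 (Or.inl ⟨h, hy₂ hs⟩)
  linarith

/-- `Nonneg` forces `0 ≤ C₀x + C₁y`. [folklore] -/
theorem evZ_nonneg {σ x y : ℤ} (hx : 0 < x) (hy₁ : σ = 1 → 0 ≤ y) (hy₂ : σ = -1 → y ≤ 0) {C : ℤ × ℤ}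
    (h : Nonneg σ C) : 0 ≤ evZ x y C := by
  simp only [evZ, AddMonoidHom.coe_mk, ZeroHom.coe_mk]
  obtain ⟨h1, h2⟩ := h
  have t1 : 0 ≤ C.1 * x := mul_nonneg h1 hx.le
  have t2 : 0 ≤ C.2 * y := by
    rcases h2 with h | ⟨hs, h⟩ | ⟨hs, h⟩
    · rw [h, zero_mul]
    · exact mul_nonneg h (hy₁ hs)
    · exact mul_nonneg_of_nonpos_of_nonpos h (hy₂ hs)
  linarith

/-! ### The sign-aware residue form of `PairOK` and the class check -/

/-- One coordinate of the class check: `Φv` a representative of the phase shift mod `8`, `C` the coefficient pair (`S = Sab C`),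
trim COEFFICIENTS `lo, hi` (own block) and `lo', hi'` (other block). [folklore] -/
def OKsf (σ Φv : ℤ) (C : ℤ × ℤ) (φ φ' : ℤ) (lo hi lo' hi' : ℕ) : Prop :=
  (φ - φ' - Φv) % 8 ≠ 0 ∧
    ((φ - φ' - Φv - 1) % 8 = 0 → Nonpos σ C ∨ Sab C ≤ hi' ∨ Sab C ≤ lo) ∧
    ((φ - φ' - Φv + 1) % 8 = 0 → Nonneg σ C ∨ Sab C ≤ lo' ∨ Sab C ≤ hi)

/-- `OKsf` is decidable. [folklore] -/
instance (σ Φv : ℤ) (C : ℤ × ℤ) (φ φ' : ℤ) (lo hi lo' hi' : ℕ) : Decidable (OKsf σ Φv C φ φ' lo hi lo' hi') := by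
  unfold OKsf; infer_instance

/-- Class data for the golden family: the box (`α = A`, `β = B` lattice elements, `W`-level `t`), the 2-D phase pattern per column
and the four trim-coefficient tables. [folklore] -/
structure ClassDataG where
  /-- lattice coordinates of `α` -/
  A : (ℤ × ℤ) × (ℤ × ℤ)
  /-- lattice coordinates of `β` -/
  B : (ℤ × ℤ) × (ℤ × ℤ)
  /-- the `b`-exponent of the third `W`-element -/
  t : ZMod 5
  /-- phase pairs used per column (subsets of `[0,8)²`) -/
  P : Fin 3 × Fin 3 → Finset (ℤ × ℤ)
  /-- bottom-trim coefficients, real coordinate -/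
  lo₁ : Fin 3 × Fin 3 → ℤ × ℤ → ℕ
  /-- top-trim coefficients, real coordinate -/
  hi₁ : Fin 3 × Fin 3 → ℤ × ℤ → ℕ
  /-- bottom-trim coefficients, imaginary coordinate -/
  lo₂ : Fin 3 × Fin 3 → ℤ × ℤ → ℕ
  /-- top-trim coefficients, imaginary coordinate -/
  hi₂ : Fin 3 × Fin 3 → ℤ × ℤ → ℕ

namespace ClassDataG

variable (cd : ClassDataG)

/-- Number of phase blocks used. [folklore] -/
def MIS : ℕ := ∑ c, #(cd.P c)

/-- Total trim coefficient `Σ (lo₁ + hi₁ + lo₂ + hi₂)`. [folklore] -/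
def SigT : ℕ := ∑ c, ∑ φ ∈ cd.P c, (cd.lo₁ c φ + cd.hi₁ c φ + cd.lo₂ c φ + cd.hi₂ c φ)

/-- The coefficient pair of a column pair, real coordinate. [folklore] -/
def CR (c c' : Fin 3 × Fin 3) : ℤ × ℤ := coefR cd.A cd.B cd.t c c'
/-- The coefficient pair of a column pair, imaginary coordinate. [folklore] -/
def CI (c c' : Fin 3 × Fin 3) : ℤ × ℤ := coefI cd.A cd.B cd.t c c'

/-- The pair condition of the class check: `OKsf` in the real OR the imaginary coordinate, phase shifts `C₀γ₀ + C₁γ₁ (mod 8)`. [folklore] -/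
def PairBarG (σ : ℤ) (γ₀ γ₁ : ZMod 8) (c c' : Fin 3 × Fin 3) (φ φ' : ℤ × ℤ) : Prop :=
  OKsf σ ((ev8 γ₀ γ₁ (cd.CR c c')).val : ℤ) (cd.CR c c') φ.1 φ'.1 (cd.lo₁ c φ) (cd.hi₁ c φ) (cd.lo₁ c' φ') (cd.hi₁ c' φ') ∨
  OKsf σ ((ev8 γ₀ γ₁ (cd.CI c c')).val : ℤ) (cd.CI c c') φ.2 φ'.2 (cd.lo₂ c φ) (cd.hi₂ c φ) (cd.lo₂ c' φ') (cd.hi₂ c' φ')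

/-- `PairBarG` is decidable. [folklore] -/
instance (σ : ℤ) (γ₀ γ₁ : ZMod 8) (c c' : Fin 3 × Fin 3) (φ φ' : ℤ × ℤ) : Decidable (cd.PairBarG σ γ₀ γ₁ c c' φ φ') := by
  unfold PairBarG; infer_instance

/-- A coefficient pair is *small*: entries in `[−4, 4]`, not both zero (then its value `c₀X + c₁Y` is nonzero for `p ≥ 49`,
as `p ∤ c₀² − c₀c₁ − c₁² ∈ [−48, 48] ∖ {0}`). [folklore] -/
def Small (v : ℤ × ℤ) : Prop := v ≠ 0 ∧ |v.1| ≤ 4 ∧ |v.2| ≤ 4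

/-- `Small` is decidable. [folklore] -/
instance (v : ℤ × ℤ) : Decidable (Small v) := by unfold Small; infer_instance

/-- **The class check** for residues `(γ₀, γ₁)`, sign datum `σ` and coefficient bound `Smax`: the box is nondegenerate for every
`p ≥ 49` (a small nonzero coordinate of `α` and of `β`), `t ≠ 0`, phases in `[0,8)²`, all coefficient sums `≤ Smax`, and the pair
condition for every ordered pair of distinct columns and phases. [folklore] -/
def ClassOKG (σ : ℤ) (γ₀ γ₁ : ZMod 8) (Smax : ℕ) : Prop :=
  (Small cd.A.1 ∨ Small cd.A.2) ∧ (Small cd.B.1 ∨ Small cd.B.2) ∧ cd.t ≠ 0 ∧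
    (∀ c, ∀ φ ∈ cd.P c, (0 ≤ φ.1 ∧ φ.1 < 8) ∧ (0 ≤ φ.2 ∧ φ.2 < 8)) ∧
    (∀ c c', c ≠ c' → Sab (cd.CR c c') ≤ Smax ∧ Sab (cd.CI c c') ≤ Smax) ∧
    (∀ c c', c ≠ c' → ∀ φ ∈ cd.P c, ∀ φ' ∈ cd.P c', cd.PairBarG σ γ₀ γ₁ c c' φ φ')

/-- The class check is decidable. [folklore] -/
instance (σ : ℤ) (γ₀ γ₁ : ZMod 8) (Smax : ℕ) : Decidable (cd.ClassOKG σ γ₀ γ₁ Smax) := by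
  unfold ClassOKG; infer_instance

end ClassDataG

/-! ### Per-prime exact certificates -/

/-- The exact pair check at the prime `p` for the Thue pair `(x, y)`: `PhaseArcs.PairOK` with the phase shift replaced by the residue
representative of `C₀γ₀ + C₁γ₁` (`γ₀ = −px`, `γ₁ = −py (mod 8)`) and the exact error `C₀x + C₁y`, integer trims. [folklore] -/
def CertOK (p : ℕ) (x y : ℤ) (A B : (ℤ × ℤ) × (ℤ × ℤ)) (t : ZMod 5) (P : Fin 3 × Fin 3 → Finset (ℤ × ℤ))
    (lo₁ hi₁ lo₂ hi₂ : Fin 3 × Fin 3 → ℤ × ℤ → ℕ) : Prop :=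
  ∀ c c', c ≠ c' → ∀ φ ∈ P c, ∀ φ' ∈ P c',
    PhaseArcs.PairOK p ((ev8 (-((p : ZMod 8) * x)) (-((p : ZMod 8) * y)) (coefR A B t c c')).val : ℤ)
        (evZ x y (coefR A B t c c')) φ.1 φ'.1 (lo₁ c φ) (hi₁ c φ) (lo₁ c' φ') (hi₁ c' φ') ∨
      PhaseArcs.PairOK p ((ev8 (-((p : ZMod 8) * x)) (-((p : ZMod 8) * y)) (coefI A B t c c')).val : ℤ)
        (evZ x y (coefI A B t c c')) φ.2 φ'.2 (lo₂ c φ) (hi₂ c φ) (lo₂ c' φ') (hi₂ c' φ')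

/-- `CertOK` is decidable. [folklore] -/
instance (p : ℕ) (x y : ℤ) (A B : (ℤ × ℤ) × (ℤ × ℤ)) (t : ZMod 5) (P : Fin 3 × Fin 3 → Finset (ℤ × ℤ))
    (lo₁ hi₁ lo₂ hi₂ : Fin 3 × Fin 3 → ℤ × ℤ → ℕ) : Decidable (CertOK p x y A B t P lo₁ hi₁ lo₂ hi₂) := by
  unfold CertOK; infer_instance

/-- Sanity check of the lattice calculus: `ζ⁵ = 1` on lattice elements. [folklore] -/
example : lzpow 5 ((1, 0), (0, 0)) = ((1, 0), (0, 0)) := by decide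

/-- Sanity check: the coefficient pairs of `ζ^s · X` (`s = 0..4`) are `X, ζX, −X + Yζ, −Y − Yζ, Y − Xζ` (`Gold.act_gz_mul_thue`). [folklore] -/
example : (List.range 5).map (fun k => lzpow k ((1, 0), (0, 0))) =
    [((1, 0), (0, 0)), ((0, 0), (1, 0)), ((-1, 0), (0, 1)), ((0, -1), (0, -1)), ((0, 1), (-1, 0))] := by decide

end GoldArcs

end Summit.MatrixMultiplication.OmegaCensus
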